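import Summits.ResolutionOfSingularities.ResolutionOfSingularities.Theorems.ProximityCutAxis
import Summits.ResolutionOfSingularities.ResolutionOfSingularities.Theorems.PlanarCutMoves
import HarnessLib

/-!
# WallCutRun — decomp-res node «LossIsolation — second kernel file WallCutRun (lens-3 g25; critic rows 189/189c:
node CLEARED, this file landed at 0 as a tool)», tree file 1/3 of the node

Content VERBATIM from the decomp-res lens-3 g25 kernel file `HOME/decomp-res-lens-3/g25/WallCutRun.lean` (PIN sha256
84202afa, 839 l, 37 theorems; HOME = run/shared/lean/pub/decomp-res), the second kernel file of the node
«LossIsolation» (first file `Theorems/WallCutCritical`, already in the tree): imports the LANDED tree only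
(`Theorems.ProximityCutAxis`, `Theorems.PlanarCutMoves`) and carries nothing — every declaration is new, namespace
`…Theorems.WallCutRun`.  Farm (critic's own run of this sha): rc 0 · 0 err · 0 sorry · axioms std · 37 dupNamespace
warnings only (the library's option).  Critic: CRITIC-LEDGER row 189 (node CLEARED, booked 0) and row 189c / INBOX
:1068 (this file PINNED 07:04:36Z = the sha farmed; LAND as `Theorems/WallCutRun.lean --kind proof --supports
stmt-ResolutionOfSingularities-27367`, together with WallCutCritical).  No aside switch (the lens-3 live aside stays
27367 `NoLossyStrictTailsDeep`, whose informal already carries the g25 reduction to the sub-critical shades).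

The lens header, verbatim:

> # WallCutRun — the RUN CALCULUS of the loss-isolation mechanism, kernel part (decomp-res-lens-3 g25, LEMMA D (D1)/(D6))
>
> Along a STRAIGHT RUN — consecutive moves at the origin of one fixed chart `j` (`W.j (t+i) = j`, `W.b (t+i) = 0`) — the
> controlled transform acts on exponents by the chart-exponent map `d ↦ d[j ↦ |d| − q]`, injectively and coefficient-
> preserving.  A THIN monomial (off-`j` degree `σ_j(d) < q`) is never deleted by the cleaning and never cancelled, so it is
> TRANSPORTED along the run with its coefficient, its off-`j` part unchanged and its degree dropping by `q − σ_j(d)` per move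
> (`thin_step`, `thin_run`).  Consequences: (D1) FATNESS off `j` (no thin monomial) is INVARIANT under a move at the origin
> of chart `j` (`fat_iff_fat_succ_axis`); (D6) the HORIZON INEQUALITY `ordZero F_{t+k} + k·(q − σ_j(d)) ≤ |d|` for every thin
> monomial `d` of `F_t` (`run_horizon`): a thin monomial of small degree excess cannot survive a long run, which is the
> diagonal bookkeeping behind the obstruction count of the loss-isolation node (NODE-g25 §3.D).  The infinite case is the
> tree's axis law (`ProximityCut.no_thin_monomial` / `noAxisTails_holds`); this file is its finite, quantitative form.
> Second part (any translation `b`, `b_j = 0`): every monomial of `F_{t+1}` has a SOURCE in `F_t`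
(`exists_source_of_mem_support_succ`),
> whence the THIN-DEGREE BOUND (`degree_lt_of_thin_succ`: in-wall-thin monomials have degree `≤ 3q − 2` — the
soundness of an all-stage
> fatness test) and the crude LAYER BOUND; and the unit-free LAYER STRUCTURE: `chartTransform q j F_t = u^A · Q` with
> `A = r off j + (o − q)e_j`, `Q` the `s`-chart transform of `F_t/u^r` (`chartTransform_eq_monomial_mul`), so that
> `F_{t+1} = clean(translate(u^A) · Ψ̃)`; the lowest terms of the unit `translate(u^A) =
u^{kept}·u_j^{o−q}·Π_{lost}(u_i + b_i)^{r_i}` and the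
> coordinatewise-minimal monomials of `Ψ̃` survive in the product (`coeff_add_mul_of_minimal`), which gives SHARP SOURCES
> (`sharp_source`): below every monomial of `F_{t+1}` lies one with `σ_j ≤ |kept| + s + (layer)` — the lost walls'
unit does not enter.
> Third part: the FIRST-RUN SURVIVAL THEOREM `exists_token_of_run_after_move` — after any move, `k` untranslated
moves in a chart
> `i ≠ j` on a shade-`s` plateau force a monomial of `F_{t+1}` inside an explicit arithmetic region R(s, |kept|,
kept(i), o, k, q)
> (sharp layer bound ∧ thin for `i` ∧ horizon inequality); R = ∅ is the death test (D4) of the run calculus (desk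
check: |R| equals the
> engine's token count in every recorded case — 30, 11, 4, 1, 0 at (q,s,o) = (8,5,12); 5, 1, 0 at (4,3,6); 14, 1, 0
at (8,6,13)).
> Fourth part, the degree half of the deviation calculus (LEMMA E): `source_run` (pull-back of every monomial along a run),
> `order_succ_add_le_of_axis_move` / `chart_switch_test` (an untranslated move in chart `c` forces `o_u + s + |r_u
off c| ≤ |d| + σ_c(d)`
> for every monomial whose image is not a `q`-th power) and `order_succ_le_of_unique_fibre` (a translated move: a
monomial alone in its
> fibre over `Z = {b = 0}` puts its floor monomial into `F_{u+1}`, bounding the next order by its `Z`-degree).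
> All `q`, all fields; imports `Theorems.ProximityCutAxis` and `Theorems.PlanarCutMoves` (for
`PlanarCut.not_isolatedTop_of_fat`).

## This file

§Run — the chart-exponent map of a straight run (`d ↦ d[j ↦ |d| − q]`, injective, coefficient-preserving), THIN
monomials transported along the run (`thin_step`, `thin_run`), (D1) fatness off `j` invariant under a move at the
origin of chart `j` (`fat_iff_fat_succ_axis`), (D6) the HORIZON INEQUALITY (`run_horizon`) — continued in
`WallCutRun2`… (sources of monomials of `F_{t+1}`, thin-degree / layer bounds, sharp sources, the first-run survival
theorem, the degree half of the deviation calculus) where the 400-line cap cuts.  (This first part carries `section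
Run`: `degree_chartExponent_add`, `thin_step`, `thin_run`, `run_horizon`,
`exists_chartExponent_eq_of_mem_support_succ`, `source_run`, `fat_iff_fat_succ_axis`, `fat_iff_fat_run`,
`kept_eq_erase_of_axis`, `erase_r_succ_of_axis`, `order_succ_of_axis`, `run_order`.)

[WRITER NOTE (decomp-res writer g12): file split only (tree files ≤ 400 lines); namespace, sections, section
variables / opens and every declaration exactly as in the lens.]

(Sources: Hauser2010 (kangaroo points, oblique polynomials); HauserPerlega2019 §2; Moh1987; CossartPiltant2008 §2;
CossartJannsenSaito2020 Ch. 8; Hironaka2005 (order under permissible blow-up); Perlega2022 (residual order is not monotone).)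
-/

open MvPolynomial
open Literature.AlgebraicGeometry.Resolution
open Literature.AlgebraicGeometry.Resolution.Hauser2010
open Literature.AlgebraicGeometry.Resolution.PointBlowup
open Summit.ResolutionOfSingularities.ResolutionOfSingularities.Theorems.TightDefectClasses
open Summit.ResolutionOfSingularities.ResolutionOfSingularities.Theorems.TightDefectStrongWalks
open Summit.ResolutionOfSingularities.ResolutionOfSingularities.Theorems.ItineraryCutClasses
open Summit.ResolutionOfSingularities.ResolutionOfSingularities.Theorems.BoundaryLedger
open Summit.ResolutionOfSingularities.ResolutionOfSingularities.Theorems.ProximityCut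

namespace Summit.ResolutionOfSingularities.ResolutionOfSingularities.Theorems.WallCutRun

section Run

variable {K : Type} [Field K] [DecidableEq K] {q : ℕ} {s₀ : State (Fin 3) K}

/-- The chart exponent of a monomial of degree `≥ q`: `|d'| + q = |d| + σ_j(d)`. [folklore] -/
theorem degree_chartExponent_add (q : ℕ) (j : Fin 3) {d : Fin 3 →₀ ℕ} (hd : q ≤ d.degree) :
    (chartExponent q j d).degree + q = d.degree + (Finsupp.erase j d).degree := by
  have h1 := degree_erase_add (chartExponent q j d) j
  rw [chartExponent_erase, chartExponent_self] at h1
  omega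

/-- **THIN TRANSPORT, ONE MOVE (PROVED).**  A move at the origin of chart `j` carries every THIN monomial `d` of `F_t`
(off-`j` degree `< q`) to the monomial `d[j ↦ |d| − q]` of `F_{t+1}` with the SAME coefficient: it is not cancelled (the chart
exponent map is injective in degree `≥ q`) and not cleaned (a thin exponent of a cleaned state is never a `q`-th power after the
move).  Extracted from the inductive step of the tree's `no_thin_monomial`. [folklore] -/
theorem thin_step (hs : IsRoot q s₀) (W : ForcedWalk q s₀) (t : ℕ) {j : Fin 3} (hj : W.j t = j) (hb : W.b t = 0)
    {d : Fin 3 →₀ ℕ} (hd : d ∈ (W.st t).F.support) (hthin : (Finsupp.erase j d).degree < q) :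
    chartExponent q j d ∈ (W.st (t + 1)).F.support ∧
      coeff (chartExponent q j d) (W.st (t + 1)).F = coeff d (W.st t).F := by
  classical
  have hdeg : q ≤ d.degree := le_degree_of_mem_support hs W t hd
  have hsum := degree_erase_add d j
  have hd0 : coeff d (W.st t).F ≠ 0 := mem_support_iff.mp hd
  have hall : ∀ d' ∈ (W.st t).F.support, q ≤ d'.degree := fun d' hd' => le_degree_of_mem_support hs W t hd'
  have hcoeff := coeff_chartTransform_chartExponent (q := q) (j := j) _ hall hd
  have hcer : Finsupp.erase j (chartExponent q j d) = Finsupp.erase j d := chartExponent_erase q j d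
  have hcj : chartExponent q j d j = d.degree - q := chartExponent_self q j d
  have hcsum := degree_erase_add (chartExponent q j d) j
  have hndvd : ¬ IsPthPowerExponent q d := not_isPthPowerExponent_of_mem_support hs W t hd
  have hnP : ¬ IsPthPowerExponent q (chartExponent q j d) := by
    by_cases hα : Finsupp.erase j d = 0
    · -- pure `u_j`-power before and after
      have hα' : (Finsupp.erase j d).degree = 0 := by rw [hα, map_zero]
      have hdj : d = Finsupp.single j (d j) := eq_single_of_erase_eq_zero hα
      have hcsingle : chartExponent q j d = Finsupp.single j (chartExponent q j d j) :=
        eq_single_of_erase_eq_zero (by rw [hcer, hα])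
      have hjpos : d j ≠ 0 := by omega
      have hjq : ¬ q ∣ d j := by
        intro hdvd
        refine hndvd ?_
        rw [hdj, isPthPowerExponent_single_iff hjpos]
        exact hdvd
      by_cases hcj0 : chartExponent q j d j = 0
      · -- then `d j = q`, a `q`-th power: excluded
        exfalso
        refine hjq ?_
        have : d j = q := by omega
        rw [this]
      · rw [hcsingle, isPthPowerExponent_single_iff hcj0, hcj]
        intro hdvd
        refine hjq ?_
        have : d j = d.degree - q + q := by omega
        rw [this]
        exact dvd_add hdvd (dvd_refl q)
    · -- some off-`j` exponent lies strictly between `0` and `q`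
      obtain ⟨i, hi⟩ : ∃ i, Finsupp.erase j d i ≠ 0 := by
        by_contra hnone
        push Not at hnone
        exact hα (Finsupp.ext hnone)
      have hij : i ≠ j := by
        rintro rfl
        exact hi Finsupp.erase_same
      have hci : chartExponent q j d i = d i := by
        have := congrArg (fun c : Fin 3 →₀ ℕ => c i) hcer
        simp only [Finsupp.erase_ne hij] at this
        exact this
      have hdi : d i ≠ 0 := by rwa [Finsupp.erase_ne hij] at hi
      have hdi_le : d i ≤ (Finsupp.erase j d).degree := by
        have := Finsupp.le_degree i (Finsupp.erase j d)
        rwa [Finsupp.erase_ne hij] at this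
      intro hP
      have hdvd := hP i (by rw [Finsupp.mem_support_iff, hci]; exact hdi)
      rw [hci] at hdvd
      exact Nat.not_dvd_of_pos_of_lt (Nat.pos_of_ne_zero hdi) (by omega) hdvd
  have hcF : coeff (chartExponent q j d) (W.st (t + 1)).F = coeff d (W.st t).F := by
    rw [st_succ_F_axis W t hj hb, coeff_deletePthPowers, if_neg hnP, hcoeff]
  exact ⟨by rw [mem_support_iff, hcF]; exact hd0, hcF⟩

/-- **THIN TRANSPORT ALONG A RUN (PROVED).**  After `k` consecutive moves at the origin of chart `j` a thin monomial `d` of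
`F_t` has an image in the support of `F_{t+k}` with the same off-`j` part and degree `|d| − k·(q − σ_j(d))`. [folklore] -/
theorem thin_run (hs : IsRoot q s₀) (W : ForcedWalk q s₀) {t k : ℕ} {j : Fin 3}
    (hrun : ∀ i, i < k → W.j (t + i) = j ∧ W.b (t + i) = 0)
    {d : Fin 3 →₀ ℕ} (hd : d ∈ (W.st t).F.support) (hthin : (Finsupp.erase j d).degree < q) :
    ∃ d' ∈ (W.st (t + k)).F.support, Finsupp.erase j d' = Finsupp.erase j d ∧
      d'.degree + k * (q - (Finsupp.erase j d).degree) = d.degree := by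
  induction k with
  | zero => exact ⟨d, hd, rfl, by simp⟩
  | succ k ih =>
    obtain ⟨d', hd', her, hdeg⟩ := ih (fun i hi => hrun i (by omega))
    have hthin' : (Finsupp.erase j d').degree < q := by rw [her]; exact hthin
    have hjk := hrun k (by omega)
    obtain ⟨hmem, -⟩ := thin_step hs W (t + k) hjk.1 hjk.2 hd' hthin'
    have hdeg1 := degree_chartExponent_add q j (le_degree_of_mem_support hs W (t + k) hd')
    rw [her] at hdeg1
    refine ⟨chartExponent q j d', hmem, by rw [chartExponent_erase, her], ?_⟩
    rw [Nat.succ_mul]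
    omega

/-- **(D6) THE HORIZON INEQUALITY (PROVED).**  If the walk makes `k` consecutive moves at the origin of chart `j`
from stage `t`,
then every thin monomial `d` of `F_t` satisfies `ordZero F_{t+k} + k·(q − σ_j(d)) ≤ |d|`: a thin monomial of degree excess `a`
over `ordZero F_t` survives at most `a / ((ordZero F_{t+k} − ordZero F_t)/k + q − σ_j(d))` moves — the diagonal
bookkeeping of the
run calculus. [new] [folklore] -/
theorem run_horizon (hs : IsRoot q s₀) (W : ForcedWalk q s₀) {t k : ℕ} {j : Fin 3}
    (hrun : ∀ i, i < k → W.j (t + i) = j ∧ W.b (t + i) = 0)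
    {d : Fin 3 →₀ ℕ} (hd : d ∈ (W.st t).F.support) (hthin : (Finsupp.erase j d).degree < q)
    {o' : ℕ} (ho' : ordZero (W.st (t + k)).F = o') :
    o' + k * (q - (Finsupp.erase j d).degree) ≤ d.degree := by
  obtain ⟨d', hd', -, hdeg⟩ := thin_run hs W hrun hd hthin
  have h2 : o' ≤ d'.degree := by
    by_contra hlt
    push Not at hlt
    refine (mem_support_iff.mp hd') (coeff_eq_zero_of_degree_lt_ordZero ?_)
    rw [ho']
    exact_mod_cast hlt
  omega

/-- Every monomial after a move at the origin of chart `j` is the chart exponent of a monomial before. [folklore] -/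
theorem exists_chartExponent_eq_of_mem_support_succ (W : ForcedWalk q s₀) (t : ℕ) {j : Fin 3} (hj : W.j t = j)
    (hb : W.b t = 0) {d' : Fin 3 →₀ ℕ} (hd' : d' ∈ (W.st (t + 1)).F.support) :
    ∃ d ∈ (W.st t).F.support, chartExponent q j d = d' := by
  classical
  have h0 : coeff d' (W.st (t + 1)).F ≠ 0 := mem_support_iff.mp hd'
  rw [st_succ_F_axis W t hj hb, coeff_deletePthPowers] at h0
  by_cases hP : IsPthPowerExponent q d'
  · rw [if_pos hP] at h0
    exact absurd rfl h0
  · rw [if_neg hP] at h0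
    unfold chartTransform at h0
    rw [coeff_sum] at h0
    obtain ⟨d, hd, hne⟩ := Finset.exists_ne_zero_of_sum_ne_zero h0
    refine ⟨d, hd, ?_⟩
    by_contra hcd
    rw [coeff_monomial, if_neg hcd] at hne
    exact hne rfl

/-- **PULL-BACK ALONG A RUN (PROVED).**  After `k` untranslated moves in chart `j` from stage `t`, every monomial
`e'` of `F_{t+k}` is the
`k`-fold chart image of a monomial `e` of `F_t` with the same off-`j` part and `|e'| + k·q = |e| + k·σ_j(e)` (thin
monomials lose degree,
fat ones gain).  With `exists_token_le_of_thin` this describes the thin part of `F` at the END of a run: it lies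
above the transported
tokens — the input of the fibre-uniqueness test `order_succ_le_of_unique_fibre`. [folklore] -/
theorem source_run (hs : IsRoot q s₀) (W : ForcedWalk q s₀) {t k : ℕ} {j : Fin 3}
    (hrun : ∀ i, i < k → W.j (t + i) = j ∧ W.b (t + i) = 0)
    {e' : Fin 3 →₀ ℕ} (he' : e' ∈ (W.st (t + k)).F.support) :
    ∃ e ∈ (W.st t).F.support, Finsupp.erase j e = Finsupp.erase j e' ∧
      e'.degree + k * q = e.degree + k * (Finsupp.erase j e).degree := by
  induction k generalizing e' with
  | zero => exact ⟨e', he', rfl, by simp⟩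
  | succ k ih =>
    have hjk := hrun k (by omega)
    obtain ⟨d, hd, hde⟩ := exists_chartExponent_eq_of_mem_support_succ W (t + k) hjk.1 hjk.2 he'
    obtain ⟨e, he, her, hdeg⟩ := ih (fun i hi => hrun i (by omega)) hd
    have hdeg1 := degree_chartExponent_add q j (le_degree_of_mem_support hs W (t + k) hd)
    rw [hde] at hdeg1
    refine ⟨e, he, ?_, ?_⟩
    · rw [her, ← hde, chartExponent_erase]
    · rw [← her] at hdeg1
      rw [Nat.succ_mul, Nat.succ_mul]
      omega

/-- **(D1) FATNESS OFF `j` IS INVARIANT UNDER A MOVE AT THE ORIGIN OF CHART `j` (PROVED).**  `F_t` has no thin monomial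
(every monomial has off-`j` degree `≥ q`, i.e. `F_t ∈ (u_i, u_{i'})^q`, the tree's FAT hypothesis of
`PlanarCut.not_isolatedTop_of_fat`) iff `F_{t+1}` has none. [new] [folklore] -/
theorem fat_iff_fat_succ_axis (hs : IsRoot q s₀) (W : ForcedWalk q s₀) (t : ℕ) {j : Fin 3} (hj : W.j t = j)
    (hb : W.b t = 0) :
    (∀ d ∈ (W.st t).F.support, q ≤ (Finsupp.erase j d).degree) ↔
      ∀ d' ∈ (W.st (t + 1)).F.support, q ≤ (Finsupp.erase j d').degree := by
  constructor
  · intro h d' hd'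
    obtain ⟨d, hd, rfl⟩ := exists_chartExponent_eq_of_mem_support_succ W t hj hb hd'
    rw [chartExponent_erase]
    exact h d hd
  · intro h d hd
    by_contra hlt
    push Not at hlt
    have h1 := (thin_step hs W t hj hb hd hlt).1
    have h2 := h _ h1
    rw [chartExponent_erase] at h2
    omega

/-- **FATNESS OFF `j` IS INVARIANT ALONG A RUN (PROVED).** [new] [folklore] -/
theorem fat_iff_fat_run (hs : IsRoot q s₀) (W : ForcedWalk q s₀) {t k : ℕ} {j : Fin 3}
    (hrun : ∀ i, i < k → W.j (t + i) = j ∧ W.b (t + i) = 0) :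
    (∀ d ∈ (W.st t).F.support, q ≤ (Finsupp.erase j d).degree) ↔
      ∀ d' ∈ (W.st (t + k)).F.support, q ≤ (Finsupp.erase j d').degree := by
  induction k with
  | zero => simp
  | succ k ih =>
    have hjk := hrun k (by omega)
    rw [ih (fun i hi => hrun i (by omega))]
    exact fat_iff_fat_succ_axis hs W (t + k) hjk.1 hjk.2

/-! ## The run ledger: along a straight run the off-`j` walls are kept and the order moves by `s + |r off j| − q` per move -/

/-- At the origin of chart `j` every old wall other than `E_j` is kept: `kept_t = r_t off j`. [folklore] -/
theorem kept_eq_erase_of_axis (W : ForcedWalk q s₀) (t : ℕ) {j : Fin 3} (hj : W.j t = j) (hb : W.b t = 0) :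
    kept W t = Finsupp.erase j (W.st t).r := by
  classical
  ext i
  rw [kept_apply, hj, hb]
  by_cases hij : i = j
  · rw [hij, Finsupp.erase_same, if_neg (fun h => h.1 rfl)]
  · rw [Finsupp.erase_ne hij, if_pos ⟨hij, rfl⟩]

/-- One move at the origin of chart `j`: the off-`j` walls are unchanged. [folklore] -/
theorem erase_r_succ_of_axis (W : ForcedWalk q s₀) (t : ℕ) {j : Fin 3} (hj : W.j t = j) (hb : W.b t = 0)
    {o : ℕ} (ho : ordZero (W.st t).F = o) :
    Finsupp.erase j (W.st (t + 1)).r = Finsupp.erase j (W.st t).r := by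
  classical
  rw [r_succ_eq W t ho, kept_eq_erase_of_axis W t hj hb, hj]
  ext i
  by_cases hij : i = j
  · rw [hij, Finsupp.erase_same, Finsupp.erase_same]
  · rw [Finsupp.erase_ne hij, Finsupp.erase_ne hij, Finsupp.add_apply, Finsupp.erase_ne hij, Finsupp.single_apply,
      if_neg (fun h => hij h.symm), add_zero]

/-- One move at the origin of chart `j` on a plateau of shade `s`: `o' + q = o + s + |r_t off j|`. [folklore] -/
theorem order_succ_of_axis (hroot : IsRoot q s₀) (W : ForcedWalk q s₀) (t : ℕ) {j : Fin 3} (hj : W.j t = j)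
    (hb : W.b t = 0) {s o o' : ℕ} (hs' : (W.st (t + 1)).shade = (s : ℕ∞)) (ho : ordZero (W.st t).F = o)
    (ho' : ordZero (W.st (t + 1)).F = o') :
    o' + q = o + s + (Finsupp.erase j (W.st t).r).degree := by
  obtain ⟨n', hn', hon'⟩ := order_eq_shade_add_degree hroot W (t + 1) ho'
  have hss : n' = s := by
    have h := hs'
    rw [hn'] at h
    exact_mod_cast h
  have hdeg := degree_r_succ W t ho
  rw [kept_eq_erase_of_axis W t hj hb] at hdeg
  have hqo : q ≤ o := by
    have h := walk_ord hroot W t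
    rw [ho] at h
    exact_mod_cast h
  omega

/-- **THE RUN LEDGER (PROVED).**  Along `k` moves at the origin of chart `j` on a plateau of shade `s` the off-`j`
walls are constant and
`ordZero F_{t+k} + k·q = ordZero F_t + k·(s + |r_t off j|)`. [folklore] -/
theorem run_order (hroot : IsRoot q s₀) (W : ForcedWalk q s₀) {t k : ℕ} {j : Fin 3}
    (hrun : ∀ i, i < k → W.j (t + i) = j ∧ W.b (t + i) = 0) {s : ℕ}
    (hsh : ∀ i, i ≤ k → (W.st (t + i)).shade = (s : ℕ∞)) {o o' : ℕ}
    (ho : ordZero (W.st t).F = o) (ho' : ordZero (W.st (t + k)).F = o') :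
    Finsupp.erase j (W.st (t + k)).r = Finsupp.erase j (W.st t).r ∧
      o' + k * q = o + k * (s + (Finsupp.erase j (W.st t).r).degree) := by
  induction k generalizing o' with
  | zero =>
    refine ⟨rfl, ?_⟩
    have : o' = o := by
      have h := ho'
      rw [show t + 0 = t from rfl, ho] at h
      exact_mod_cast h.symm
    omega
  | succ k ih =>
    obtain ⟨om, hom, -⟩ := walk_nat hroot W (t + k)
    obtain ⟨her, hled⟩ := ih (fun i hi => hrun i (by omega)) (fun i hi => hsh i (by omega)) hom
    have hjk := hrun k (by omega)
    have h1 := erase_r_succ_of_axis W (t + k) hjk.1 hjk.2 hom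
    have h2 := order_succ_of_axis hroot W (t + k) hjk.1 hjk.2 (hsh (k + 1) le_rfl) hom ho'
    rw [her] at h1 h2
    refine ⟨h1, ?_⟩
    rw [Nat.succ_mul, Nat.succ_mul]
    omega

end Run

end Summit.ResolutionOfSingularities.ResolutionOfSingularities.Theorems.WallCutRun
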